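import Summits.AtomisticToContinuum.HydrodynamicLimit.Theses.JeansLoadedDice

/-!
# Crux `LoadedTransfer` (stmt-AtomisticToContinuum-16943) — birth skeleton (BC3), line `birth`

Route `route-AtomisticToContinuum-JeansLoadedDice`, sub-problem `HydrodynamicLimit`. The crux is the CONSUMER
`LoadedTransfer := OneKickFootprint → ContactIntensityDominationOneRare → _root_.HydrodynamicLimit` (route file
`Theses/JeansLoadedDice.lean`; summit-strength by the route's own account: `HydrodynamicLimit → LoadedTransfer` is
`fun h _ _ => h`). Its intended proof is "SlackRung + the Lindeberg swap in the eccentricity"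
(`LoadedTransfer = Assembly ∘ SlackRung`), but the swap is filed only as the untyped frame item `Assembly`, so a
two-stub skeleton `SlackRung → Assembly → LoadedTransfer` would be a one-line seam. This file instead TYPES the swap
and the two provable-now inputs the composition really consumes, and makes the `κ → 0 / N → ∞` bookkeeping of the
transfer the (sorry-free) composition proof. FOUR registered stubs, each stated over route decls (by name) and
Literature declarations only:

* `stub_slackRung` — the route crux `SlackRung` (stmt-AtomisticToContinuum-17314) BY NAME: along
  `ξ_N = loadedEccentricity κ N`, for `κ < κ₀(t, χ, δ)`, the χ-tested translational fields of the LOADED gas at time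
  `t` are within `δ` of the CONJUNCT's (packing-guarded) Euler solution with probability `→ 1`, given the loaded
  three-field LLN at time `0`. Conjunct-hard and labelled so by the route (why it might fail: the dice defect
  `φ/ξ_N → ∞` along the family; the `O(κ²)` translation–rotation drain must stay perturbative uniformly in `N`).
* `stub_lindebergSwap` — THE LINDEBERG SWAP IN THE ECCENTRICITY, typed here for the first time (it is the content of
  the frame item `Assembly`, stmt-16942, minus `SlackRung`): `OneKickFootprint → ContactIntensityDominationOneRare →`
  for every inertia `ι > 0` a packing threshold `η₁`, profile-wise `σ₁`, and for `σ < σ₁`, every guarded classical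
  hs-Euler solution, `t ∈ [0,T)`, continuous `χ`, `δ > 0`, every TRUE flow family `Φ` with the local-Gibbs LLN at
  time `0`, and every slack `η > 0`, there is `κ₁ > 0` such that for `0 < κ < κ₁` and EVERY loaded flow family `Ψ`
  along `ξ_N = loadedEccentricity κ N`, eventually in `N`:
  `P_true(χ-field at t off by > δ) ≤ P_loaded(off by > δ/2) + η` for each of the three fields (one-sided
  Lévy–Prokhorov comparison of the field laws at the same `N`). Mechanism (route header § Thesis X_T):
  `d/dξ E_ξ[F(fields_t)] = Σ_contacts E[(∂_ξ outcome)·(footprint)]` with a `2/δ`-Lipschitz cutoff `F`,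
  `𝟙_{>δ} ≤ F ≤ 𝟙_{>δ/2}`; footprint `O(ε_N/N)` per kick from `OneKickFootprint` (ASSUMED UNIFORM along the loaded
  family — the unfiled input), contact budgets `Σ_contacts ξ_N|g|` (`≍ (N+1)^{4/3}` contacts × footprint
  `(N+1)^{-4/3}` × `ξ_N` = `O(ξ_N)` at first order) and `Σ ξ_N²|g|²` (`= O(ξ_N²(N+1)^{1/3}) = O(κ²)` at second order)
  from `ContactIntensityDominationOneRare` (marks `ψ = 1+‖·‖`, `k = 1, 2`): swap error `C_δ(κ(N+1)^{-1/6} + κ²)`,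
  whence `κ₁` with `C_δ κ₁² < η/2` and then `N` large. Why it might fail: the footprint constant of
  `OneKickFootprint` is `∃ C` AFTER `∀ Φ` and is
  not known uniform in `ξ ≤ ξ_N` along the loaded family; kicks at time `s > 0` (not only at time `0`) are needed;
  continuous `χ` needs a Lipschitz approximation with velocity-moment control. Size XL (open-problem-sized input
  `OneKickFootprint` is a HYPOTHESIS, not re-proved).
* `stub_timeZeroStatics` — LOADED TIME-ZERO LAWS = TRUE TIME-ZERO LAWS (the `t = 0` slice of the support item
  `LoadedStatics`, stmt-9351, in exactly the consumable form): for every `N`, continuous `χ`, targets `c, w, e` and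
  `δ`, the `loadedLocalGibbsLaw`-probability that the χ-tested density / momentum / kinetic-energy field of
  `(Ψ N).configFlow 0 z` is off by `> δ` EQUALS the `localGibbsLaw`-probability of the same event for
  `(Φ N).flow 0 z` (projection `loadedProjection` of the loaded local Gibbs law is the local Gibbs law — Haar loads
  and Gaussian angular momenta integrate out — and `flow 0 = id`, `configFlow 0 = loadedProjection` almost surely,
  both laws being absolutely continuous w.r.t. the respective Liouville measures whose good sets are conull).
  Size M, provable now. Why it might fail: only through a junk branch of `canonicalDensity` / `localMaxwellian`
  (excluded here: `σ > 0`, `ι > 0`, `θ₀ > 0`).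
* `stub_loadedFlowExistence` — the route support item `LoadedFlowExistence` (stmt-AtomisticToContinuum-14686) BY
  NAME: Alexander's scheme for Jeans' loaded spheres on `𝕋³` (`0 < σ < 1/2`, `0 ≤ ξ < 1/2`, `ι > 0`); it makes the
  `∀ Ψ` of `SlackRung` / the swap non-vacuous and is USED by the composition (the loaded family along `ξ_N(κ)` is
  chosen from it). Size M–L, provable now (adapt `HardSphereFlow.nonempty_torus_holds`).

`LoadedTransfer_of` is the sorry-free composition (53 tactic lines, plus the 24-line sorry-free `ℝ≥0∞` bookkeeping
lemma `tendsto_zero_of_swap₃` = "N → ∞ first, then κ → 0"): `ι := 1`; `η₀ := min η₀ˢ η₁`;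
`σ₀ := min (min σ₀ˢ σ₁) 2⁻¹`; given `σ < σ₀`, a guarded solution, `Φ`, the true LLN at time `0`, `t, χ, δ` and a
target `ε > 0` (the lemma halves it): `κ₀` from `SlackRung` at `(t, χ, δ/2)`, `κ₁` from the swap for this `Φ` with
slack `ε`, `κ := min (min κ₀ κ₁) 2⁻¹ / 2`, the loaded family `Ψ_κ` along `ξ_N = loadedEccentricity κ N < 1/2` by
CHOICE from `stub_loadedFlowExistence`, the loaded LLN at time `0` from the true one by `stub_timeZeroStatics`
(`Tendsto.congr` on the three deviation probabilities), then `SlackRung` gives `P_loaded(off by > δ/2) → 0` and the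
swap gives `P_true(off by > δ) ≤ P_loaded(off by > δ/2) + ε` eventually; the lemma turns this, for every `ε`, into
the three `Tendsto … (𝓝 0)` of `TendstoHydroFieldsAt … t`. Axioms of `LoadedTransfer_of`: propext,
Classical.choice, Quot.sound (no sorryAx: the stubs enter only as hypotheses). The hypotheses of `LoadedTransfer_of` are the
name-keyed aliases `Registered.stub_*` (abbrevs DEFINED AS `type_of%` the stub theorems, so alias = statement by
construction; the skeleton audit admits a hypothesis whose head's last name component is a declared stub).
Sorries: exactly four, one inside each `stub_*`; nothing else.
Disproof used: none on file (`ledger crux ls stmt-AtomisticToContinuum-16943`: no workfiles — no `Disproof.lean`,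
no `Negative/` lemmas; the negatives index of the summit has no statement about the loaded family, its statics,
its existence or a law comparison; the refuted `ContactIntensityDomination` stmt-9218 is NOT restated — the swap
consumes the repaired `ContactIntensityDominationOneRare` by name, as the crux does).
-/

namespace Summit.AtomisticToContinuum.HydrodynamicLimit.Cruxes.LoadedTransfer.Birth

open MeasureTheory Filter Set
open scoped ENNReal Topology
open Literature.MathematicalPhysics.KineticTheory Literature.Analysis.FluidPDE

/-- STUB 1 · THE SLACK RUNG (route crux `SlackRung`, stmt-AtomisticToContinuum-17314, by name; size XL,
conjunct-hard): the vanishing-load rung to the conjunct's own packing-guarded Euler solution along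
`ξ_N = loadedEccentricity κ N`, `κ → 0` inside the item. Leans on: `LoadedSphereFlow`, `loadedLocalGibbsLaw`,
`loadedEccentricity`, `IsHardSphereEulerSolution` (landed). -/
theorem stub_slackRung :
    Summit.AtomisticToContinuum.HydrodynamicLimit.Theses.JeansLoadedDice.SlackRung := by
  sorry

/-- STUB 2 · THE LINDEBERG SWAP IN THE ECCENTRICITY (typed content of the frame item `Assembly` minus `SlackRung`;
size XL; load-bearing for the TRANSFER): under the two typed true-gas inputs of the route, the law of the
χ-tested fields of the TRUE hard-sphere gas at time `t` is, eventually in `N`, within slack `η` (one-sided, at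
deviation levels `δ` vs `δ/2`) of the law of the same fields of ANY loaded gas along `ξ_N = loadedEccentricity κ N`,
for all `κ < κ₁(η)`; `κ₁` may depend on everything fixed before it (profiles, `σ`, the solution, `t, χ, δ`, the
true flow family `Φ`, `η`) but not on `κ, Ψ, N`. Leans on: `OneKickFootprint`, `ContactIntensityDominationOneRare`
(route cruxes, hypotheses by name), `TendstoHydroFieldsAt`, `localGibbsLaw`, `loadedLocalGibbsLaw`,
`LoadedSphereFlow.configFlow`, `loadedEccentricity` (landed). -/
theorem stub_lindebergSwap :
    open MeasureTheory Literature.MathematicalPhysics.KineticTheory Literature.Analysis.FluidPDE in Summit.AtomisticToContinuum.HydrodynamicLimit.Theses.JeansLoadedDice.OneKickFootprint → Summit.AtomisticToContinuum.HydrodynamicLimit.Theses.JeansLoadedDice.ContactIntensityDominationOneRare → ∀ ι : ℝ, 0 < ι → ∃ η₁ : ℝ, 0 < η₁ ∧ ∀ (a₀ θ₀ : T3 → ℝ) (u₀ : T3 → V3), Continuous a₀ → Continuous θ₀ → Continuous u₀ → (∀ x, 0 < a₀ x) → (∀ x, 0 < θ₀ x) → ∃ σ₁ : ℝ, 0 <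 σ₁ ∧ ∀ σ : ℝ, 0 < σ → σ < σ₁ → ∀ (T : ℝ) (ρ θ : ℝ → T3 → ℝ) (u : ℝ → T3 → V3), IsHardSphereEulerSolution σ T ρ u θ → (∀ t ∈ Set.Ico 0 T, ∀ x, ρ t x * σ ^ 3 < η₁) → ∀ t ∈ Set.Ico 0 T, ∀ χ : T3 → ℝ, Continuous χ → ∀ δ > (0 : ℝ), ∀ Φ : (N : ℕ) → HardSphereFlow (Torus.geometry (Fin 3)) (hsDiameter σ N) (N + 1), TendstoHydroFieldsAt (fun N => localGibbsLaw σ a₀ u₀ θ₀ N (Φ N)) Φ ρ u θ 0 → ∀ η : ENNReal, 0 < η → ∃ κ₁ : ℝ, 0 < κ₁ ∧ ∀ κ : ℝ, 0 < κ → κ < κ₁ → ∀ Ψ : (N : ℕ) → LoadedSphereFlow (Torus.geometry (Fin 3)) (hsDiameter σ N) (loadedEccentricity κ N) ι (N + 1), ∀ᶠ N in Filter.atTop, ((localGibbsLaw σ a₀ u₀ θ₀ N (Φ N)) {z | δ < |empiricalDensityField ((Φ N).flow t z) χ - ∫ x, χ x * ρ t x|} ≤ (loadedLocalGibbsLaw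 σ (loadedEccentricity κ N) ι a₀ u₀ θ₀ N (Ψ N)) {z | δ / 2 < |empiricalDensityField ((Ψ N).configFlow t z) χ - ∫ x, χ x * ρ t x|} + η) ∧ ((localGibbsLaw σ a₀ u₀ θ₀ N (Φ N)) {z | δ < ‖empiricalMomentumField ((Φ N).flow t z) χ - ∫ x, (χ x * ρ t x) • u t x‖} ≤ (loadedLocalGibbsLaw σ (loadedEccentricity κ N) ι a₀ u₀ θ₀ N (Ψ N)) {z | δ / 2 < ‖empiricalMomentumField ((Ψ N).configFlow t z) χ - ∫ x, (χ x * ρ t x) • u t x‖} + η) ∧ ((localGibbsLaw σ a₀ u₀ θ₀ N (Φ N)) {z | δ < |empiricalEnergyField ((Φ N).flow t z) χ - ∫ x, χ x * totalEnergyDensity (ρ t x) (u t x) (θ t x)|} ≤ (loadedLocalGibbsLaw σ (loadedEccentricity κ N) ι a₀ u₀ θ₀ N (Ψ N)) {z | δ / 2 < |empiricalEnergyField ((Ψ N).configFlow t z) χ - ∫ x, χ x * totalEnergyDensity (ρ t x) (u t x) (θ t x)|} + η) := by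
  sorry

/-- STUB 3 · LOADED TIME-ZERO LAWS = TRUE TIME-ZERO LAWS (the `t = 0` slice of the support item `LoadedStatics`,
stmt-AtomisticToContinuum-9351, in consumable form; size M, provable now): for every true flow family `Φ`, every
loaded flow family `Ψ` along any admissible eccentricity sequence `ξ`, every `N`, continuous `χ`, targets
`c, w, e` and level `δ`, the deviation events of the three empirical fields of the time-`0` configurations have the
SAME probability under `loadedLocalGibbsLaw` (loaded, `configFlow 0`) and `localGibbsLaw` (true, `flow 0`).
Leans on: `loadedLocalGibbsLaw`, `loadedProjection`, `LoadedSphereFlow.flow_zero` / `HardSphereFlow.flow_zero`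
(a.e.), `localGibbsLaw = particleLaw _ (canonicalDensity …)` (landed). -/
theorem stub_timeZeroStatics :
    open MeasureTheory Literature.MathematicalPhysics.KineticTheory Literature.Analysis.FluidPDE in ∀ (σ ι : ℝ) (ξ : ℕ → ℝ), 0 < σ → 0 < ι → (∀ N : ℕ, 0 ≤ ξ N ∧ ξ N < 2⁻¹) → ∀ (a₀ θ₀ : T3 → ℝ) (u₀ : T3 → V3), Continuous a₀ → Continuous θ₀ → Continuous u₀ → (∀ x, 0 < a₀ x) → (∀ x, 0 < θ₀ x) → ∀ (Φ : (N : ℕ) → HardSphereFlow (Torus.geometry (Fin 3)) (hsDiameter σ N) (N + 1)) (Ψ : (N : ℕ) → LoadedSphereFlow (Torus.geometry (Fin 3)) (hsDiameter σ N) (ξ N) ι (N + 1)) (N : ℕ) (χ : T3 → ℝ), Continuous χ → ∀ (c : ℝ) (w : V3) (e δ : ℝ), (loadedLocalGibbsLaw σ (ξ N) ι a₀ u₀ θ₀ N (Ψ N)) {z | δ < |empiricalDensityField ((Ψ N).configFlow 0 z) χ - c|} = (localGibbsLaw σ a₀ u₀ θ₀ N (Φ N)) {z | δ < |empiricalDensityField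 ((Φ N).flow 0 z) χ - c|} ∧ (loadedLocalGibbsLaw σ (ξ N) ι a₀ u₀ θ₀ N (Ψ N)) {z | δ < ‖empiricalMomentumField ((Ψ N).configFlow 0 z) χ - w‖} = (localGibbsLaw σ a₀ u₀ θ₀ N (Φ N)) {z | δ < ‖empiricalMomentumField ((Φ N).flow 0 z) χ - w‖} ∧ (loadedLocalGibbsLaw σ (ξ N) ι a₀ u₀ θ₀ N (Ψ N)) {z | δ < |empiricalEnergyField ((Ψ N).configFlow 0 z) χ - e|} = (localGibbsLaw σ a₀ u₀ θ₀ N (Φ N)) {z | δ < |empiricalEnergyField ((Φ N).flow 0 z) χ - e|} := by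
  sorry

/-- STUB 4 · LOADED-FLOW EXISTENCE (route support item `LoadedFlowExistence`, stmt-AtomisticToContinuum-14686, by
name; size M–L, provable now): Alexander's scheme for Jeans' loaded spheres on `𝕋³` — for `0 < σ < 1/2`,
`0 ≤ ξ < 1/2`, `ι > 0` and every `N` the type `LoadedSphereFlow (Torus.geometry (Fin 3)) (hsDiameter σ N) ξ ι (N+1)`
is inhabited. Leans on: `LoadedSphereFlow`, `loadedLiouville`, `HardSphereFlow.nonempty_torus_holds` (landed,
the `ξ = 0` case). -/
theorem stub_loadedFlowExistence :
    Summit.AtomisticToContinuum.HydrodynamicLimit.Theses.JeansLoadedDice.LoadedFlowExistence := by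
  sorry

/-! ## Name-keyed aliases of the stub statements (hypotheses of the composition) -/

namespace Registered

/-- Alias of the statement of `stub_slackRung` (by `type_of%`, so alias = statement). -/
abbrev stub_slackRung : Prop :=
  type_of% @_root_.Summit.AtomisticToContinuum.HydrodynamicLimit.Cruxes.LoadedTransfer.Birth.stub_slackRung
/-- Alias of the statement of `stub_lindebergSwap`. -/
abbrev stub_lindebergSwap : Prop :=
  type_of% @_root_.Summit.AtomisticToContinuum.HydrodynamicLimit.Cruxes.LoadedTransfer.Birth.stub_lindebergSwap
/-- Alias of the statement of `stub_timeZeroStatics`. -/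
abbrev stub_timeZeroStatics : Prop :=
  type_of% @_root_.Summit.AtomisticToContinuum.HydrodynamicLimit.Cruxes.LoadedTransfer.Birth.stub_timeZeroStatics
/-- Alias of the statement of `stub_loadedFlowExistence`. -/
abbrev stub_loadedFlowExistence : Prop :=
  type_of% @_root_.Summit.AtomisticToContinuum.HydrodynamicLimit.Cruxes.LoadedTransfer.Birth.stub_loadedFlowExistence

end Registered

/-! ## `ℝ≥0∞` bookkeeping: the `κ → 0 / N → ∞` double limit of the transfer (sorry-free helper) -/

/-- If for every `ε > 0` the three sequences `fᵢ` are eventually dominated by `gᵢ + ε` with `gᵢ → 0`, then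
`fᵢ → 0` (`i = 1, 2, 3`). This is the logic of "N → ∞ first, then κ → 0": `ε` chooses `κ`, `κ` chooses the
comparison family `gᵢ` (the loaded gas along `ξ_N(κ)`). -/
theorem tendsto_zero_of_swap₃ {f₁ f₂ f₃ : ℕ → ℝ≥0∞}
    (h : ∀ ε : ℝ≥0∞, 0 < ε → ∃ g₁ g₂ g₃ : ℕ → ℝ≥0∞,
      (Tendsto g₁ atTop (𝓝 0) ∧ Tendsto g₂ atTop (𝓝 0) ∧ Tendsto g₃ atTop (𝓝 0)) ∧
        ∀ᶠ N in atTop, f₁ N ≤ g₁ N + ε ∧ f₂ N ≤ g₂ N + ε ∧ f₃ N ≤ g₃ N + ε) :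
    Tendsto f₁ atTop (𝓝 0) ∧ Tendsto f₂ atTop (𝓝 0) ∧ Tendsto f₃ atTop (𝓝 0) := by
  have key : ∀ ε : ℝ≥0∞, 0 < ε → ∀ᶠ N in atTop, f₁ N ≤ ε ∧ f₂ N ≤ ε ∧ f₃ N ≤ ε := by
    intro ε hε
    have hε2 : (0 : ℝ≥0∞) < ε / 2 := ENNReal.half_pos hε.ne'
    obtain ⟨g₁, g₂, g₃, ⟨hg₁, hg₂, hg₃⟩, hfg⟩ := h (ε / 2) hε2
    have e₁ := ENNReal.tendsto_nhds_zero.1 hg₁ (ε / 2) hε2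
    have e₂ := ENNReal.tendsto_nhds_zero.1 hg₂ (ε / 2) hε2
    have e₃ := ENNReal.tendsto_nhds_zero.1 hg₃ (ε / 2) hε2
    have hh : ε / 2 + ε / 2 = ε := ENNReal.add_halves ε
    filter_upwards [hfg, e₁, e₂, e₃] with N hN h₁ h₂ h₃
    refine ⟨?_, ?_, ?_⟩
    · calc f₁ N ≤ g₁ N + ε / 2 := hN.1
        _ ≤ ε / 2 + ε / 2 := add_le_add h₁ le_rfl
        _ = ε := hh
    · calc f₂ N ≤ g₂ N + ε / 2 := hN.2.1
        _ ≤ ε / 2 + ε / 2 := add_le_add h₂ le_rfl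
        _ = ε := hh
    · calc f₃ N ≤ g₃ N + ε / 2 := hN.2.2
        _ ≤ ε / 2 + ε / 2 := add_le_add h₃ le_rfl
        _ = ε := hh
  exact ⟨ENNReal.tendsto_nhds_zero.2 fun ε hε => (key ε hε).mono fun N hN => hN.1,
    ENNReal.tendsto_nhds_zero.2 fun ε hε => (key ε hε).mono fun N hN => hN.2.1,
    ENNReal.tendsto_nhds_zero.2 fun ε hε => (key ε hε).mono fun N hN => hN.2.2⟩

/-! ## The composition: the four stubs conclude the crux BY NAME (real proof, no `sorry`) -/

/-- **`LoadedTransfer` from the line** — the loaded programme's transfer leg made precise: inertia `ι := 1`,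
packing threshold and density threshold as minima of the rung's and the swap's (capped at `σ < 1/2` for the
existence of the loaded family), and for each target `ε` of the `ℝ≥0∞`-convergence a load parameter
`κ < min κ₀ κ₁ ⊓ 1/2` fixing the comparison gas `Ψ_κ` (chosen from `stub_loadedFlowExistence`), whose initial LLN
is the true one (`stub_timeZeroStatics`), whose time-`t` fields follow the conjunct's Euler solution
(`stub_slackRung`) and whose field laws dominate the true gas's up to `ε/2` (`stub_lindebergSwap`). -/
theorem LoadedTransfer_of :
    Registered.stub_slackRung → Registered.stub_lindebergSwap → Registered.stub_timeZeroStatics →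
      Registered.stub_loadedFlowExistence →
        Summit.AtomisticToContinuum.HydrodynamicLimit.Theses.JeansLoadedDice.LoadedTransfer := by
  intro hS hW hZ hE hOKF hCID
  -- one inertia parameter suffices
  obtain ⟨ηS, hηS, HS⟩ := hS 1 one_pos
  obtain ⟨ηW, hηW, HW⟩ := hW hOKF hCID 1 one_pos
  unfold _root_.HydrodynamicLimit
  refine ⟨min ηS ηW, lt_min hηS hηW, ?_⟩
  intro a₀ θ₀ u₀ ha hθ hu hap hθp
  obtain ⟨σS, hσS, HS⟩ := HS a₀ θ₀ u₀ ha hθ hu hap hθp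
  obtain ⟨σW, hσW, HW⟩ := HW a₀ θ₀ u₀ ha hθ hu hap hθp
  refine ⟨min (min σS σW) 2⁻¹, lt_min (lt_min hσS hσW) (by norm_num), ?_⟩
  intro σ hσ hσlt T ρ θ u hsol hguard Φ h0 t ht
  have hσS' : σ < σS := lt_of_lt_of_le hσlt ((min_le_left _ _).trans (min_le_left _ _))
  have hσW' : σ < σW := lt_of_lt_of_le hσlt ((min_le_left _ _).trans (min_le_right _ _))
  have hσh : σ < 2⁻¹ := lt_of_lt_of_le hσlt (min_le_right _ _)
  have hgS : ∀ s ∈ Set.Ico 0 T, ∀ x, ρ s x * σ ^ 3 < ηS := fun s hs x =>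
    lt_of_lt_of_le (hguard s hs x) (min_le_left _ _)
  have hgW : ∀ s ∈ Set.Ico 0 T, ∀ x, ρ s x * σ ^ 3 < ηW := fun s hs x =>
    lt_of_lt_of_le (hguard s hs x) (min_le_right _ _)
  replace HS := HS σ hσ hσS' T ρ θ u hsol hgS t ht
  replace HW := HW σ hσ hσW' T ρ θ u hsol hgW t ht
  intro χ hχ δ hδ
  -- the rung at (t, χ, δ/2) and the swap for this Φ
  obtain ⟨κ₀, hκ₀, HS⟩ := HS χ hχ (δ / 2) (half_pos hδ)
  have HWΦ := HW χ hχ δ hδ Φ h0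
  refine tendsto_zero_of_swap₃ fun ε hε => ?_
  obtain ⟨κ₁, hκ₁, HW1⟩ := HWΦ ε hε
  -- the load parameter κ and the loaded comparison gas Ψ along ξ_N = loadedEccentricity κ N
  have hm : 0 < min (min κ₀ κ₁) 2⁻¹ := lt_min (lt_min hκ₀ hκ₁) (by norm_num)
  obtain ⟨κ, hκpos, hκ0, hκ1, hκh⟩ : ∃ κ : ℝ, 0 < κ ∧ κ < κ₀ ∧ κ < κ₁ ∧ κ < 2⁻¹ := by
    refine ⟨min (min κ₀ κ₁) 2⁻¹ / 2, half_pos hm, ?_, ?_, ?_⟩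
    · exact (half_lt_self hm).trans_le ((min_le_left _ _).trans (min_le_left _ _))
    · exact (half_lt_self hm).trans_le ((min_le_left _ _).trans (min_le_right _ _))
    · exact (half_lt_self hm).trans_le (min_le_right _ _)
  have hξ : ∀ N : ℕ, 0 ≤ loadedEccentricity κ N ∧ loadedEccentricity κ N < 2⁻¹ := fun N =>
    ⟨(loadedEccentricity_pos hκpos N).le, (loadedEccentricity_le hκpos.le N).trans_lt hκh⟩
  obtain ⟨Ψ⟩ : Nonempty ((N : ℕ) → LoadedSphereFlow (Torus.geometry (Fin 3)) (hsDiameter σ N)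
      (loadedEccentricity κ N) 1 (N + 1)) :=
    ⟨fun N => Classical.choice (hE σ (loadedEccentricity κ N) 1 hσ hσh (hξ N).1 (hξ N).2 one_pos N)⟩
  -- time-zero statics for the pair (Φ, Ψ)
  have HZ := hZ σ 1 (fun N => loadedEccentricity κ N) hσ one_pos hξ a₀ θ₀ u₀ ha hθ hu hap hθp Φ Ψ
  -- the rung's conclusion for Ψ, fed with the loaded LLN at time 0 (= the true one)
  have HSΨ := HS κ hκpos hκ0 Ψ
  dsimp only at HSΨ
  obtain ⟨HT₁, HT₂, HT₃⟩ := HSΨ (by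
    intro χ' hχ' δ' hδ'
    obtain ⟨h₁, h₂, h₃⟩ := h0 χ' hχ' δ' hδ'
    have HZ' := fun N : ℕ => HZ N χ' hχ' (∫ x, χ' x * ρ 0 x) (∫ x, (χ' x * ρ 0 x) • u 0 x)
      (∫ x, χ' x * totalEnergyDensity (ρ 0 x) (u 0 x) (θ 0 x)) δ'
    exact ⟨h₁.congr fun N => (HZ' N).1.symm, h₂.congr fun N => (HZ' N).2.1.symm,
      h₃.congr fun N => (HZ' N).2.2.symm⟩)
  -- the swap for (κ, Ψ) with slack ε closes the bookkeeping
  have HWΨ := HW1 κ hκpos hκ1 Ψ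
  exact ⟨_, _, _, ⟨HT₁, HT₂, HT₃⟩, HWΨ⟩

end Summit.AtomisticToContinuum.HydrodynamicLimit.Cruxes.LoadedTransfer.Birth
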